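import Literature.MathematicalPhysics.QuantumFieldTheory.ConformalBootstrap3D.PointKernelK34v2Data
import Literature.MathematicalPhysics.QuantumFieldTheory.ConformalBootstrap3D.PointKernelParts

/-!
# K34v2 certificate, kernel part file P68: one-cell head segments 176, 177, 178 in level ranges

The head cells whose kernel evaluation exceeds one `decide` are one-cell segments of `hsegsK34v2`; each is
checked by `PCert.hPartSideOK` (side conditions) and `PCert.hPartOK` per level range `[n_lo, n_lo + count)`
against an integer claim, the claims summing to `≥ 0` (`PointKernel.partsOK`); soundness is
`PCert.hParts_sound` (`PointKernelParts`).  The part files `P1, P2, …` are mutually independent (each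
imports only the data file); the ranges of one cell may span several of them, and the per-cell
conclusions `hparts_i` / `hcell_i` of those cells are assembled in `PointKernelK34v2.lean`.
Estimated kernel time 209 s.
-/

set_option maxRecDepth 100000
set_option maxHeartbeats 0

namespace Literature.MathematicalPhysics.QuantumFieldTheory.ConformalBootstrap3D.PointKernelK34v2

open Literature.MathematicalPhysics.QuantumFieldTheory.ConformalBootstrap3D.PointKernel

/-- levels `[0, 32)` of segment 176: partial lower sum `≥` claim. [folklore] -/
theorem part_176_0 : certK34v2.hPartOK (PCert.segAt hsegsK34v2 176) JHK34v2 0 32 (-13362232103202956544871410398773267117) = true := by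
  decide +kernel

/-- levels `[32, 41)` of segment 176: partial lower sum `≥` claim. [folklore] -/
theorem part_176_1 : certK34v2.hPartOK (PCert.segAt hsegsK34v2 176) JHK34v2 32 9 (13362232103202956544871410398773267117) = true := by
  decide +kernel

/-- one-cell segment 177 (row 6, cell `[1807/256, 113/16]`, chord, `n_F = 40`,
2 level ranges): side conditions. [folklore] -/
theorem pside_177 : certK34v2.hPartSideOK (PCert.segAt hsegsK34v2 177) JHK34v2 = true := by
  decide +kernel

/-- its level ranges `(n_lo, count, claim)`. [folklore] -/
def parts_177 : List (ℕ × ℕ × ℤ) := [(0, 32, -12848820077957661659212795355236295233), (32, 9, 12848820077957661659212795355236295234)]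

/-- the ranges tile `[0, n_F]` and the claims sum to `≥ 0`. [folklore] -/
theorem pcov_177 : PointKernel.partsOK 40 parts_177 = true := by
  decide +kernel

/-- levels `[0, 32)` of segment 177: partial lower sum `≥` claim. [folklore] -/
theorem part_177_0 : certK34v2.hPartOK (PCert.segAt hsegsK34v2 177) JHK34v2 0 32 (-12848820077957661659212795355236295233) = true := by
  decide +kernel

/-- levels `[32, 41)` of segment 177: partial lower sum `≥` claim. [folklore] -/
theorem part_177_1 : certK34v2.hPartOK (PCert.segAt hsegsK34v2 177) JHK34v2 32 9 (12848820077957661659212795355236295234) = true := by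
  decide +kernel

/-- one-cell segment 178 (row 6, cell `[113/16, 905/128]`, chord, `n_F = 48`,
3 level ranges): side conditions. [folklore] -/
theorem pside_178 : certK34v2.hPartSideOK (PCert.segAt hsegsK34v2 178) JHK34v2 = true := by
  decide +kernel

/-- its level ranges `(n_lo, count, claim)`. [folklore] -/
def parts_178 : List (ℕ × ℕ × ℤ) := [(0, 31, -18079389955388283166792122458115229810), (31, 13, 16164197525978484852509091690357869398), (44, 5, 1915192429409798314283030767757360413)]

/-- the ranges tile `[0, n_F]` and the claims sum to `≥ 0`. [folklore] -/
theorem pcov_178 : PointKernel.partsOK 48 parts_178 = true := by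
  decide +kernel

end Literature.MathematicalPhysics.QuantumFieldTheory.ConformalBootstrap3D.PointKernelK34v2
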